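import Mathlib
import Summits.Ventures.HodgeRepro.Tier4.Target
import Summits.Ventures.HodgeRepro.Tier4.Line3.Defs
import Summits.Ventures.HodgeRepro.Tier4.Line3.DefsLemmas
import Summits.Ventures.HodgeRepro.Tier4.Line3.KMDatum
import Summits.Ventures.HodgeRepro.Tier4.Line3.KMDatumS
import Summits.Ventures.HodgeRepro.Tier4.Line3.HeckeEquivarianceLemmas
import Summits.Ventures.HodgeRepro.Tier4.Line3.ClassBoundGauss
import Summits.Ventures.HodgeRepro.Tier4.Line3.Majorant
import Summits.Ventures.HodgeRepro.Tier4.Line3.SylvesterTransfer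
import Summits.Ventures.HodgeRepro.Tier4.Line3.UnitCopyScaling
import Summits.Ventures.HodgeRepro.Tier4.Line3.UnitCopyPos
import Summits.Ventures.HodgeRepro.Tier4.Line3.CopyRemainder
import Summits.Ventures.HodgeRepro.Tier4.Line3.GaussRatioFormula
import Summits.Ventures.HodgeRepro.Tier4.Line3.CopyWeightBound
import Summits.Ventures.HodgeRepro.Tier4.Line3.CopyWeightGaussian

/-!
# Tier4/Line3/CopyWeightBoundShrink — the `N`-free weight of EVERY copy (shrinking scalars included) against the main
term, under the displayed exponential-moment bound (HK) of the majorant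

Blind re-derivation cell `pub-hodge-repro`, Tier 4 «PROVE THE STEP», LINE L3, seat t4-x2 (g3, reserve wall-breaker); the
CUT named by t4-plan-3 g3 on bus S13870 («the shrinking half is the one nobody holds»).

THE OBSTRUCTION.  For a copy with a SHRINKING scalar (`t_j := ‖τ₀ ε_j‖ < 1`) the kernel scaling factor carries
`e^{+π (1 − t_j²) maj(y_j, z)}`, UNBOUNDED on the ball (the majorant `maj ≥ 0` tends to `∞` at the boundary): no bound
`kernelScale ≤ const` exists, and the copy's archimedean integral `∫_𝔹 kernelScale · kernel xm = ∫_𝔹 kernel (ε • xm)` is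
`∫ |P|² e^{−π Σ_j t_j² maj_j}` — finite, but POLYNOMIALLY large in `1/t_j` through the boundary growth of the datum
(`KMDatumS.growth`), with constants depending on the datum and on the centre's boundary geometry (bus S13860 (F4)).  A
closed-form majorant therefore has to carry those constants as parameters.

THE DISPLAY.  `MajorantMomentBound D xm A k` («(HK)»): for every `s ∈ [0, 1)⁴` the exponential moment
`∫_𝔹 e^{π Σ_j s_j maj_j} · Re kernel xm` is finite and `≤ A · ∏_j (1 − s_j)^{−k} · Re I_∞(xm)` — a property of the PAIR
(datum, centre) only (no copy, no scalar), polynomial in `1/(1 − s_j)`.  It is TRUE for the genuine datum and a centre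
whose first two slots span a `J`-positive plane (no boundary point is `J`-orthogonal to the whole plane, so the coercive
part of the other slots' Gaussians kills the polynomial growth), with `k` the growth exponent of the datum; its proof is the
boundary analysis that is NOT done here — it is displayed.

THE THEOREM.  `weight_le_shrinkMaj`: for EVERY copy (no restriction on the scalars), under (HK),

  `weight c o ≤ shrinkMaj A k ε xm · ‖Λ(o)‖ · Re I_∞(xm)`,
  `shrinkMaj A k ε xm = A · ∏_j t_j² · ∏_j (min 1 t_j²)^{−k} · exp(−π Σ_j (t_j² − 1)⁺ tauSize (xm j)) · exp(−π defSize ε xm)`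

(`(t² − 1)⁺ = max 0 (t² − 1)`): the pointwise identity `−(t² − 1) = max 0 (1 − t²) − max 0 (t² − 1)` splits the scaling
exponent into the exponential moment at `s_j = max 0 (1 − t_j²)` and the coercive Gaussian `e^{−π (t_j² − 1)⁺ tauSize}`
(CopyWeightGaussian `tauSize_le_maj`).  On non-shrinking copies `shrinkMaj = A · (∏ t_j²) · e^{−π profileExc}`
(`shrinkMaj_of_one_le`): CopyWeightGaussian's bound with the constant `A` (which (HK) may take `= 1` at `s = 0`).
With v0.43's `CopyMajorant` binder (bus S13870) this makes the whole of (R-a′) ONE pure count over the scalar tuples, with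
(HK) displayed.  Nothing here says anything about the status of the Hodge conjecture for CM abelian varieties, which is
NOT proved (HC_CM is NOT proved by anyone in this repository).
-/

set_option autoImplicit false

noncomputable section

namespace Summit.Ventures.HodgeRepro.Tier4.Line3

open Summit.Ventures.HodgeRepro.Tier4
open Matrix NumberField MeasureTheory
open scoped ComplexConjugate

namespace T4Data

variable (X : T4Data)

/-- **(HK) THE EXPONENTIAL-MOMENT BOUND OF THE MAJORANT UNDER THE MAIN KERNEL** (DISPLAYED): for every `s ∈ [0, 1)⁴`
the function `e^{π Σ_j s_j maj(y_j, z)} · Re kernel(xm, z)` is integrable on the ball with integral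
`≤ A · ∏_j (1 − s_j)^{−k} · Re I_∞(xm)`. -/
def MajorantMomentBound (D : X.ThetaData) (xm : X.Tuple) (A k : ℝ) : Prop :=
  ∀ s : Fin 4 → ℝ, (∀ j, 0 ≤ s j ∧ s j < 1) →
    IntegrableOn (fun z => Real.exp (Real.pi * ∑ j, s j * maj (X.ballCoord (xm j)) z) * (X.kernel D.Φ xm z).re) ball ∧
    ∫ z in ball, Real.exp (Real.pi * ∑ j, s j * maj (X.ballCoord (xm j)) z) * (X.kernel D.Φ xm z).re ≤
      A * (∏ j, (1 - s j) ^ (-k)) * (∫ z in ball, X.kernel D.Φ xm z).re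

/-- **THE CLOSED-FORM SHRINKING MAJORANT** of the copy `ε • x` with the (HK) constants `A, k`. -/
def shrinkMaj (A k : ℝ) (ε : Fin 4 → X.E) (x : X.Tuple) : ℝ :=
  A * (∏ j, ‖X.τ₀ (ε j)‖ ^ 2) * (∏ j, (min 1 (‖X.τ₀ (ε j)‖ ^ 2)) ^ (-k)) *
    Real.exp (-(Real.pi * ∑ j, max 0 (‖X.τ₀ (ε j)‖ ^ 2 - 1) * X.tauSize (x j))) *
    Real.exp (-(Real.pi * X.defSize ε x))

/-- The shrinking parameter of a scalar: `s = max 0 (1 − t²)`. -/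
def shrinkParam (ε : Fin 4 → X.E) (j : Fin 4) : ℝ := max 0 (1 - ‖X.τ₀ (ε j)‖ ^ 2)

/-- `0 ≤ s_j < 1` for a non-zero scalar. -/
theorem shrinkParam_mem {ε : Fin 4 → X.E} (hε : ∀ j, ε j ≠ 0) (j : Fin 4) :
    0 ≤ X.shrinkParam ε j ∧ X.shrinkParam ε j < 1 := by
  have ht : 0 < ‖X.τ₀ (ε j)‖ := norm_pos_iff.2 ((map_ne_zero _).2 (hε j))
  refine ⟨le_max_left _ _, ?_⟩
  unfold shrinkParam
  rw [max_lt_iff]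
  exact ⟨one_pos, by nlinarith⟩

/-- `1 − s_j = min 1 t_j²`. -/
theorem one_sub_shrinkParam (ε : Fin 4 → X.E) (j : Fin 4) :
    1 - X.shrinkParam ε j = min 1 (‖X.τ₀ (ε j)‖ ^ 2) := by
  unfold shrinkParam
  rcases le_total 1 (‖X.τ₀ (ε j)‖ ^ 2) with h | h
  · rw [min_eq_left h, max_eq_left (by linarith)]
    ring
  · rw [min_eq_right h, max_eq_right (by linarith)]
    ring

/-- The pointwise split of the scaling exponent: on the ball,
`exp(−π (t² − 1) maj) ≤ exp(π s maj) · exp(−π (t² − 1)⁺ tauSize)` with `s = max 0 (1 − t²)`. -/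
theorem exp_scale_le (ε : Fin 4 → X.E) (x : X.Tuple) (j : Fin 4) {z : Fin 2 → ℂ} (hz : z ∈ ball) :
    Real.exp (-(Real.pi * ((‖X.τ₀ (ε j)‖ ^ 2 - 1) * maj (X.ballCoord (x j)) z))) ≤
      Real.exp (Real.pi * (X.shrinkParam ε j * maj (X.ballCoord (x j)) z)) *
        Real.exp (-(Real.pi * (max 0 (‖X.τ₀ (ε j)‖ ^ 2 - 1) * X.tauSize (x j)))) := by
  rw [← Real.exp_add]
  apply Real.exp_le_exp.2
  have hm : X.tauSize (x j) ≤ maj (X.ballCoord (x j)) z := X.tauSize_le_maj (x j) hz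
  have hp : 0 ≤ max 0 (‖X.τ₀ (ε j)‖ ^ 2 - 1) := le_max_left _ _
  have hsplit : -(‖X.τ₀ (ε j)‖ ^ 2 - 1) = X.shrinkParam ε j - max 0 (‖X.τ₀ (ε j)‖ ^ 2 - 1) := by
    unfold shrinkParam
    rcases le_total 1 (‖X.τ₀ (ε j)‖ ^ 2) with h | h
    · rw [max_eq_left (by linarith), max_eq_right (by linarith)]
      ring
    · rw [max_eq_right (by linarith), max_eq_left (by linarith)]
      ring
  have h1 : max 0 (‖X.τ₀ (ε j)‖ ^ 2 - 1) * X.tauSize (x j) ≤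
      max 0 (‖X.τ₀ (ε j)‖ ^ 2 - 1) * maj (X.ballCoord (x j)) z := mul_le_mul_of_nonneg_left hm hp
  have h2 : -(Real.pi * ((‖X.τ₀ (ε j)‖ ^ 2 - 1) * maj (X.ballCoord (x j)) z)) =
      Real.pi * (X.shrinkParam ε j * maj (X.ballCoord (x j)) z) -
        Real.pi * (max 0 (‖X.τ₀ (ε j)‖ ^ 2 - 1) * maj (X.ballCoord (x j)) z) := by
    linear_combination (Real.pi * maj (X.ballCoord (x j)) z) * hsplit
  rw [h2]
  nlinarith [Real.pi_pos, h1]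

/-- The kernel scaling factor of ANY copy, on the ball: `kernelScale ≤ (∏ t_j²) · e^{π Σ s_j maj_j} · e^{−π Σ (t_j² − 1)⁺ tauSize}`. -/
theorem kernelScale_le_shrink (ε : Fin 4 → X.E) (x : X.Tuple) {z : Fin 2 → ℂ} (hz : z ∈ ball) :
    X.kernelScale ε x z ≤ (∏ j, ‖X.τ₀ (ε j)‖ ^ 2) *
      (Real.exp (Real.pi * ∑ j, X.shrinkParam ε j * maj (X.ballCoord (x j)) z) *
        Real.exp (-(Real.pi * ∑ j, max 0 (‖X.τ₀ (ε j)‖ ^ 2 - 1) * X.tauSize (x j)))) := by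
  unfold kernelScale
  have hexp : Real.exp (Real.pi * ∑ j, X.shrinkParam ε j * maj (X.ballCoord (x j)) z) *
      Real.exp (-(Real.pi * ∑ j, max 0 (‖X.τ₀ (ε j)‖ ^ 2 - 1) * X.tauSize (x j))) =
      ∏ j, (Real.exp (Real.pi * (X.shrinkParam ε j * maj (X.ballCoord (x j)) z)) *
        Real.exp (-(Real.pi * (max 0 (‖X.τ₀ (ε j)‖ ^ 2 - 1) * X.tauSize (x j))))) := by
    rw [Finset.prod_mul_distrib, ← Real.exp_sum, ← Real.exp_sum, Finset.mul_sum, Finset.mul_sum,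
      ← Finset.sum_neg_distrib]
  rw [hexp, ← Finset.prod_mul_distrib]
  refine Finset.prod_le_prod (fun j _ => mul_nonneg (pow_nonneg (norm_nonneg _) 2) (Real.exp_pos _).le)
    fun j _ => ?_
  exact mul_le_mul_of_nonneg_left (X.exp_scale_le ε x j hz) (pow_nonneg (norm_nonneg _) 2)

/-- **THE WEIGHT OF ANY COPY AGAINST THE MAIN TERM, UNDER (HK).** -/
theorem weight_le_shrinkMaj (D : X.ThetaData) (S : Set (Fin 4 → X.E)) (xm : X.Tuple) (h02 : xm 2 = xm 0)
    (h13 : xm 3 = xm 1) {A k : ℝ} (hHK : X.MajorantMomentBound D xm A k) (c : X.CopyData D S xm) (o : X.Orbit)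
    (hε : ∀ j, c.rep o j ≠ 0) :
    c.weight o ≤ X.shrinkMaj A k (c.rep o) xm * ‖c.lam o 0 * c.lam o 1 * conj (c.lam o 2 * c.lam o 3)‖ *
      (∫ z in ball, X.kernel D.Φ xm z).re := by
  unfold CopyData.weight
  obtain ⟨hint, hmom⟩ := hHK (X.shrinkParam (c.rep o)) (X.shrinkParam_mem hε)
  -- the constant in front of the exponential moment
  set B : ℝ := (∏ j, ‖X.τ₀ (c.rep o j)‖ ^ 2) *
    Real.exp (-(Real.pi * ∑ j, max 0 (‖X.τ₀ (c.rep o j)‖ ^ 2 - 1) * X.tauSize (xm j))) with hB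
  have hB0 : 0 ≤ B := mul_nonneg (Finset.prod_nonneg fun _ _ => pow_nonneg (norm_nonneg _) 2) (Real.exp_pos _).le
  -- the kernel is a non-negative real for the symmetric centre
  have hkr : ∀ z, ‖X.kernel D.Φ xm z‖ = (X.kernel D.Φ xm z).re := fun z => X.norm_kernel_symm D.Φ xm h02 h13 z
  have hkr0 : ∀ z, 0 ≤ (X.kernel D.Φ xm z).re := fun z => (hkr z) ▸ norm_nonneg _
  -- the archimedean factor of the copy against the exponential moment
  have hk : ‖∫ z in ball, ((X.kernelScale (c.rep o) xm z : ℝ) : ℂ) * X.kernel D.Φ xm z‖ ≤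
      B * ∫ z in ball, Real.exp (Real.pi * ∑ j, X.shrinkParam (c.rep o) j * maj (X.ballCoord (xm j)) z) *
        (X.kernel D.Φ xm z).re := by
    refine (norm_integral_le_integral_norm _).trans ?_
    rw [← integral_const_mul]
    refine integral_mono_of_nonneg (Filter.Eventually.of_forall fun z => norm_nonneg _)
      (hint.const_mul _) ?_
    refine ae_restrict_of_forall_mem HeckeEquivariance.isOpen_ball'.measurableSet fun z hz => ?_
    show ‖((X.kernelScale (c.rep o) xm z : ℝ) : ℂ) * X.kernel D.Φ xm z‖ ≤
      B * (Real.exp (Real.pi * ∑ j, X.shrinkParam (c.rep o) j * maj (X.ballCoord (xm j)) z) * (X.kernel D.Φ xm z).re)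
    rw [norm_mul, Complex.norm_real, Real.norm_eq_abs, abs_of_nonneg (X.kernelScale_nonneg _ _ _), hkr]
    have h1 := X.kernelScale_le_shrink (c.rep o) xm hz
    calc X.kernelScale (c.rep o) xm z * (X.kernel D.Φ xm z).re
        ≤ ((∏ j, ‖X.τ₀ (c.rep o j)‖ ^ 2) *
          (Real.exp (Real.pi * ∑ j, X.shrinkParam (c.rep o) j * maj (X.ballCoord (xm j)) z) *
            Real.exp (-(Real.pi * ∑ j, max 0 (‖X.τ₀ (c.rep o j)‖ ^ 2 - 1) * X.tauSize (xm j))))) *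
          (X.kernel D.Φ xm z).re := mul_le_mul_of_nonneg_right h1 (hkr0 z)
      _ = B * (Real.exp (Real.pi * ∑ j, X.shrinkParam (c.rep o) j * maj (X.ballCoord (xm j)) z) *
          (X.kernel D.Φ xm z).re) := by rw [hB]; ring
  -- the exponential moment against the main term, with `1 − s_j = min 1 t_j²`
  have hprod : (∏ j, (1 - X.shrinkParam (c.rep o) j) ^ (-k)) =
      ∏ j, (min 1 (‖X.τ₀ (c.rep o j)‖ ^ 2)) ^ (-k) :=
    Finset.prod_congr rfl fun j _ => by rw [X.one_sub_shrinkParam]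
  rw [hprod] at hmom
  have hg0 : 0 ≤ X.gaussRatio (c.rep o) xm := (X.gaussRatio_pos _ _).le
  calc ‖∫ z in ball, ((X.kernelScale (c.rep o) xm z : ℝ) : ℂ) * X.kernel D.Φ xm z‖ *
        ‖c.lam o 0 * c.lam o 1 * conj (c.lam o 2 * c.lam o 3)‖ * X.gaussRatio (c.rep o) xm
      ≤ (B * ∫ z in ball, Real.exp (Real.pi * ∑ j, X.shrinkParam (c.rep o) j * maj (X.ballCoord (xm j)) z) *
          (X.kernel D.Φ xm z).re) *
        ‖c.lam o 0 * c.lam o 1 * conj (c.lam o 2 * c.lam o 3)‖ * X.gaussRatio (c.rep o) xm := by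
          gcongr
    _ ≤ (B * (A * (∏ j, (min 1 (‖X.τ₀ (c.rep o j)‖ ^ 2)) ^ (-k)) * (∫ z in ball, X.kernel D.Φ xm z).re)) *
        ‖c.lam o 0 * c.lam o 1 * conj (c.lam o 2 * c.lam o 3)‖ * X.gaussRatio (c.rep o) xm := by
          gcongr
    _ = X.shrinkMaj A k (c.rep o) xm * ‖c.lam o 0 * c.lam o 1 * conj (c.lam o 2 * c.lam o 3)‖ *
        (∫ z in ball, X.kernel D.Φ xm z).re := by
          rw [X.gaussRatio_eq_exp]
          unfold shrinkMaj
          rw [hB]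
          ring

/-- On a non-shrinking copy the shrinking majorant is `A · (∏ t_j²) · e^{−π profileExc}` — CopyWeightGaussian's bound
with the constant `A`. -/
theorem shrinkMaj_of_one_le (A k : ℝ) {ε : Fin 4 → X.E} (hε : ∀ j, 1 ≤ ‖X.τ₀ (ε j)‖) (x : X.Tuple) :
    X.shrinkMaj A k ε x = A * (∏ j, ‖X.τ₀ (ε j)‖ ^ 2) * Real.exp (-(Real.pi * X.profileExc ε x)) := by
  unfold shrinkMaj profileExc
  have h1 : ∀ j, min 1 (‖X.τ₀ (ε j)‖ ^ 2) = 1 := fun j => min_eq_left (by nlinarith [hε j, norm_nonneg (X.τ₀ (ε j))])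
  have h2 : ∀ j, max 0 (‖X.τ₀ (ε j)‖ ^ 2 - 1) = ‖X.τ₀ (ε j)‖ ^ 2 - 1 :=
    fun j => max_eq_right (by nlinarith [hε j, norm_nonneg (X.τ₀ (ε j))])
  simp only [h1, h2, Real.one_rpow, Finset.prod_const_one, mul_one]
  rw [mul_assoc, ← Real.exp_add]
  congr 2
  ring

end T4Data

end Summit.Ventures.HodgeRepro.Tier4.Line3

end
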